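import Summits.QuantumFields.YangMills.Theorems.Z2SelfDualityCounting
import Summits.QuantumFields.YangMills.Theses.ModularSelfDualFold
import Literature.MathematicalPhysics.QuantumLattice.LatticeGaugeDLR
import HarnessLib

/-!
# Kramers–Wannier / Wegner self-duality of four-dimensional `ℤ₂` lattice gauge theory on the torus

Proof of `Summit.QuantumFields.YangMills.Theses.ModularSelfDualFold.Z2TorusFreeEnergySelfDuality`
(item stmt-QuantumFields-9638 of route ModularSelfDualFold — the abelian, level-one prototype of the
route's modular self-duality; a support item, no summit statement is proved here): for the gauge
group `ℤ₂ = Multiplicative (ZMod 2)` (Borel σ-algebra of the discrete topology, representation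
`z2Rep`, Wilson action `∑ₚ (1 - σ_p)`, Haar = uniform) on the tori `(ℤ/(L+1)ℤ)^4`,

  `(L+1)^{-4} · [log Z_{L+1}(β) - log Z_{L+1}(β*)] → 3 log (2 cosh² β) - 6β`, `β* = -½ log tanh β`,

for every `β > 0` (Wegner, J. Math. Phys. 12 (1971) 2259, §IV; Balian–Drouffe–Itzykson, Phys. Rev.
D 11 (1975) 2098, §III.C). Assembly of the tree files `Z2SelfDualityExpansions` (high-temperature
character expansion `Z(β) = (e^{-β} cosh β)^{6N} ∑_{S even} t^{#S}` and low-temperature form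
`Z(β*) = 2^{-4N} K ∑_{η exact} t^{#supp η}`, `t = tanh β = e^{-2β*}`, `N = (L+1)^4`),
`Z2SelfDualityDualMap` (self-duality of the cells in `d = 4`: `∑_{S even} = ∑_{η closed}`),
`Z2SelfDualityCounting` (`2^{N-1} ≤ K ≤ 2^{N + 4(L+1)^3}` and
`∑_{exact} ≤ ∑_{closed} ≤ (2/t)^{32 (L+1)^3} ∑_{exact}`, from the box Poincaré lemmas
`Z2SelfDualityBoxPoincare` / `Z2SelfDualityTorusPrimitives`): the torus corrections are
`O((L+1)^3)` in the logarithm, hence invisible in the free energy per site.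
-/

noncomputable section

namespace Summit.QuantumFields.YangMills.Theorems.Z2SelfDuality

open Finset Filter Topology
open Literature.MathematicalPhysics.QuantumLattice (z2Rep torusLogPartition)
open Literature.MathematicalPhysics.QuantumFieldTheory

/-! ### The two partition functions in closed form -/

section PartitionFunction

variable {M : ℕ} [NeZero M] [Fact (1 < M)] [MeasurableSpace Z2] [BorelSpace Z2]

/-- **High-temperature / dual form of the `ℤ₂` torus partition function** (`d = 4`, `M ≥ 2`):
`Z(β) = (e^{-β} cosh β)^{6 M⁴} · A(tanh β)` with `A` the sum of `t^{#supp η}` over the closed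
`ℤ₂`-valued plaquette functions. [cite: SeilerLNP1982, Ch. 1 (duality transformations)] -/
theorem partitionFunction_z2_eq_closedSum (β : ℝ) :
    (partitionFunction (d := 4) (L := M) z2Rep β).toReal =
      (Real.exp (-β) * Real.cosh β) ^ (M ^ 4 * 6) * closedSum M (Real.tanh β) := by
  -- `#Edge = 4 M⁴`, `#Plaquette = 6 M⁴` (cf. the tree's `SelfNormalisedSkewness.Negative.card_edge`)
  have hE : Fintype.card (Edge 4 M) = M ^ 4 * 4 := by
    rw [Fintype.card_prod, Fintype.card_fun, ZMod.card, Fintype.card_fin]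
  have h6 : Fintype.card {q : Fin 4 × Fin 4 // q.1 < q.2} = 6 := by decide
  have hP : Fintype.card (Plaquette 4 M) = M ^ 4 * 6 := by
    rw [Fintype.card_prod, Fintype.card_fun, ZMod.card, Fintype.card_fin, h6]
  rw [partitionFunction_toReal_eq, sum_exp_eq_highTemp, evenSum_eq_closedSum, hE, hP]
  have h2 : (Fintype.card Z2 : ℝ) = 2 := by simp
  rw [h2, ← mul_assoc, ← mul_assoc, mul_comm (((2 : ℝ)⁻¹) ^ (M ^ 4 * 4)), mul_assoc _ _ ((2 : ℝ) ^ (M ^ 4 * 4)),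
    ← mul_pow, inv_mul_cancel₀ (two_ne_zero), one_pow, mul_one]

omit [Fact (1 < M)] in
/-- **Low-temperature form of the `ℤ₂` torus partition function at the dual coupling**
`β* = -(log t)/2`: `Z(β*) = 2^{-4 M⁴} · K · B(t)` with `K` the number of flat configurations and
`B` the sum of `t^{#supp η}` over exact plaquette functions. [cite: SeilerLNP1982, Ch. 1] -/
theorem partitionFunction_z2_dual_eq_exactSum {t : ℝ} (ht : 0 < t) :
    (partitionFunction (d := 4) (L := M) z2Rep (-(Real.log t) / 2)).toReal =
      ((2 : ℝ)⁻¹) ^ (M ^ 4 * 4) * ((flatCount 4 M : ℝ) * exactSum 4 M t) := by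
  have hE : Fintype.card (Edge 4 M) = M ^ 4 * 4 := by
    rw [Fintype.card_prod, Fintype.card_fun, ZMod.card, Fintype.card_fin]
  rw [partitionFunction_toReal_eq, sum_exp_dual_eq ht, hE]
  have h2 : (Fintype.card Z2 : ℝ) = 2 := by simp
  rw [h2]

end PartitionFunction

/-! ### Positivity and the logarithmic estimates -/

/-- The exact sum is at least `1` (the trivial configuration). [folklore] -/
theorem one_le_exactSum {M : ℕ} [NeZero M] {t : ℝ} (ht : 0 ≤ t) : 1 ≤ exactSum 4 M t := by
  classical
  unfold exactSum
  have h0 : (0 : Plaquette 4 M → Additive Z2) ∈ Finset.univ.image (plaqField (d := 4) (L := M) (G := Z2)) :=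
    Finset.mem_image.2 ⟨1, Finset.mem_univ _, plaqField_one⟩
  have hw : suppWeight t (0 : Plaquette 4 M → Additive Z2) = 1 := by simp [suppWeight]
  calc (1 : ℝ) = suppWeight t (0 : Plaquette 4 M → Additive Z2) := hw.symm
    _ ≤ _ := Finset.single_le_sum (fun η _ => by unfold suppWeight; exact pow_nonneg ht _) h0

/-- The number of flat configurations is positive. [folklore] -/
theorem flatCount_pos {M : ℕ} [NeZero M] : 0 < flatCount 4 M := by
  have h := two_mul_flatCount_ge (d := 4) (M := M)
  have : 0 < 2 ^ Fintype.card (Site 4 M) := pow_pos two_pos _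
  omega

/-- **The logarithm of the flat count is `M⁴ log 2 + O(M³)`**:
`|log K - M⁴ log 2| ≤ (1 + 4 M³) log 2`. [folklore] -/
theorem abs_log_flatCount_sub_le {M : ℕ} [NeZero M] :
    |Real.log (flatCount 4 M : ℝ) - (M : ℝ) ^ 4 * Real.log 2| ≤ (1 + 4 * (M : ℝ) ^ 3) * Real.log 2 := by
  have hK : (0 : ℝ) < flatCount 4 M := by exact_mod_cast flatCount_pos
  have hlog2 : 0 < Real.log 2 := Real.log_pos one_lt_two
  -- `#Site = M⁴` (cf. the tree's `FemtoCurvatureTwoPoint.PlaquetteVariance.card_site`)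
  have hS : Fintype.card (Site 4 M) = M ^ 4 := by
    rw [Fintype.card_fun, ZMod.card, Fintype.card_fin]
  -- lower bound `2^{M⁴} ≤ 2 K`
  have hlow : (M : ℝ) ^ 4 * Real.log 2 ≤ Real.log 2 + Real.log (flatCount 4 M : ℝ) := by
    have h := two_mul_flatCount_ge (d := 4) (M := M)
    rw [hS] at h
    have h' : (2 : ℝ) ^ (M ^ 4) ≤ 2 * (flatCount 4 M : ℝ) := by exact_mod_cast h
    have := Real.log_le_log (by positivity) h'
    rw [Real.log_pow, Real.log_mul two_ne_zero hK.ne'] at this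
    push_cast at this
    linarith
  -- upper bound `K ≤ 2^{M⁴ + #seamEdge}`, `#seamEdge ≤ 4 M³`
  have hup : Real.log (flatCount 4 M : ℝ) ≤ ((M : ℝ) ^ 4 + 4 * (M : ℝ) ^ 3) * Real.log 2 := by
    have h := flatCount_le (d := 4) (M := M)
    rw [hS] at h
    have hs := card_seamEdge_le (d := 4) (L := M)
    have h' : (flatCount 4 M : ℝ) ≤ (2 : ℝ) ^ (M ^ 4 + (seamEdge 4 M).card) := by exact_mod_cast h
    have := Real.log_le_log hK h'
    rw [Real.log_pow] at this
    have hs' : ((M ^ 4 + (seamEdge 4 M).card : ℕ) : ℝ) ≤ (M : ℝ) ^ 4 + 4 * (M : ℝ) ^ 3 := by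
      norm_num at hs
      have : ((seamEdge 4 M).card : ℝ) ≤ 4 * (M : ℝ) ^ 3 := by exact_mod_cast hs
      push_cast; linarith
    exact this.trans (mul_le_mul_of_nonneg_right hs' hlog2.le)
  rw [abs_le]
  constructor <;> nlinarith [hlow, hup, hlog2, pow_nonneg (Nat.cast_nonneg M : (0:ℝ) ≤ M) 3]

/-- **The closed and exact sums agree up to `O(M³)` in the logarithm** (`0 < t ≤ 1`, `M ≥ 2`):
`0 ≤ log A(t) - log B(t) ≤ 32 M³ log (2/t)`. [folklore] -/
theorem log_closedSum_sub_log_exactSum {M : ℕ} [NeZero M] [Fact (1 < M)] {t : ℝ} (ht : 0 < t)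
    (ht1 : t ≤ 1) :
    0 ≤ Real.log (closedSum M t) - Real.log (exactSum 4 M t) ∧
      Real.log (closedSum M t) - Real.log (exactSum 4 M t) ≤ 32 * (M : ℝ) ^ 3 * Real.log (2 / t) := by
  have hB : 0 < exactSum 4 M t := lt_of_lt_of_le one_pos (one_le_exactSum ht.le)
  have hAB := exactSum_le_closedSum (M := M) ht.le
  have hA : 0 < closedSum M t := lt_of_lt_of_le hB hAB
  have hlog : 0 ≤ Real.log (2 / t) := Real.log_nonneg (by rw [le_div_iff₀ ht]; linarith)
  constructor
  · linarith [Real.log_le_log hB hAB]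
  · have h := closedSum_le (M := M) ht ht1
    have hs := card_seamPlaq_le (d := 4) (L := M)
    have h1 := Real.log_le_log hA h
    rw [Real.log_mul (pow_pos (div_pos two_pos ht) _).ne' hB.ne', Real.log_pow] at h1
    have hs' : ((seamPlaq 4 M).card : ℝ) ≤ 32 * (M : ℝ) ^ 3 := by
      norm_num at hs
      exact_mod_cast hs
    nlinarith [mul_le_mul_of_nonneg_right hs' hlog]

/-! ### The self-duality theorem -/

/-- **Kramers–Wannier / Wegner self-duality of four-dimensional `ℤ₂` lattice gauge theory on the
torus, free-energy form** (item stmt-QuantumFields-9638): for every `β > 0`, with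
`β* = -½ log tanh β`,
`(L+1)^{-4} · [log Z_{L+1}(β) - log Z_{L+1}(β*)] → 3 log (2 cosh² β) - 6β`
(`Z = torusLogPartition 4 z2Rep`, the Haar-normalised torus partition function of the Wilson
`ℤ₂` theory with the Borel σ-algebra of the discrete group). High-temperature expansion of `Z(β)`
over even plaquette sets, low-temperature expansion of `Z(β*)` over exact plaquette fields, the
self-duality of the cells of the four-torus, and the box Poincaré lemmas bounding the torus
(co)homology corrections by the `O((L+1)^3)` cells of the seam.
[cite: SeilerLNP1982, Ch. 1 (duality transformations)] -/
theorem z2TorusFreeEnergySelfDuality_proof :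
    Summit.QuantumFields.YangMills.Theses.ModularSelfDualFold.Z2TorusFreeEnergySelfDuality := by
  letI : MeasurableSpace Z2 := borel _
  haveI : BorelSpace Z2 := ⟨rfl⟩
  intro β hβ
  set t := Real.tanh β with ht_def
  have ht0 : 0 < t := by
    rw [ht_def, Real.tanh_eq_sinh_div_cosh]; exact div_pos (Real.sinh_pos_iff.2 hβ) (Real.cosh_pos β)
  have ht1 : t < 1 := by rw [ht_def]; exact Real.tanh_lt_one β
  have hcosh : 0 < Real.cosh β := Real.cosh_pos β
  set c := 3 * Real.log (2 * Real.cosh β ^ 2) - 6 * β with hc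
  -- the error constant
  set C := (5 * Real.log 2 + 32 * Real.log (2 / t)) with hC
  have hmain : ∀ L : ℕ, 1 ≤ L →
      |(((L + 1 : ℕ) : ℝ) ^ 4)⁻¹ * (torusLogPartition 4 z2Rep β (L + 1) -
          torusLogPartition 4 z2Rep (-(Real.log (Real.tanh β)) / 2) (L + 1)) - c| ≤ C / ((L + 1 : ℕ) : ℝ) := by
    intro L hL
    haveI : Fact (1 < L + 1) := ⟨by omega⟩
    set M : ℕ := L + 1 with hM
    have hMpos : (0 : ℝ) < (M : ℝ) := by positivity
    have hM1 : (1 : ℝ) ≤ (M : ℝ) := by exact_mod_cast (show 1 ≤ M by omega)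
    set N : ℝ := (M : ℝ) ^ 4 with hN
    have hNpos : 0 < N := by positivity
    -- closed forms
    have hZ1 : torusLogPartition 4 z2Rep β M =
        6 * N * (Real.log (Real.cosh β) - β) + Real.log (closedSum M t) := by
      unfold torusLogPartition
      rw [partitionFunction_z2_eq_closedSum, ← ht_def]
      have hA : 0 < closedSum M t :=
        lt_of_lt_of_le (lt_of_lt_of_le one_pos (one_le_exactSum ht0.le)) (exactSum_le_closedSum ht0.le)
      rw [Real.log_mul (pow_pos (mul_pos (Real.exp_pos _) hcosh) _).ne' hA.ne', Real.log_pow,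
        Real.log_mul (Real.exp_pos _).ne' hcosh.ne', Real.log_exp]
      push_cast
      rw [hN]; ring
    have hZ2 : torusLogPartition 4 z2Rep (-(Real.log (Real.tanh β)) / 2) M =
        -(4 * N) * Real.log 2 + Real.log (flatCount 4 M : ℝ) + Real.log (exactSum 4 M t) := by
      unfold torusLogPartition
      rw [← ht_def, partitionFunction_z2_dual_eq_exactSum ht0]
      have hK : (0 : ℝ) < flatCount 4 M := by exact_mod_cast flatCount_pos
      have hB : 0 < exactSum 4 M t := lt_of_lt_of_le one_pos (one_le_exactSum ht0.le)
      rw [Real.log_mul (pow_pos (inv_pos.2 two_pos) _).ne' (mul_pos hK hB).ne', Real.log_pow,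
        Real.log_inv, Real.log_mul hK.ne' hB.ne']
      push_cast
      rw [hN]; ring
    -- the main term
    have hc' : c = 3 * Real.log 2 + 6 * Real.log (Real.cosh β) - 6 * β := by
      rw [hc, Real.log_mul two_ne_zero (pow_pos hcosh 2).ne', Real.log_pow]; push_cast; ring
    have hK := abs_log_flatCount_sub_le (M := M)
    obtain ⟨hAB0, hAB1⟩ := log_closedSum_sub_log_exactSum (M := M) ht0 ht1.le
    rw [hZ1, hZ2, hc']
    have hNM : N = (M : ℝ) ^ 4 := hN
    -- error = (log 2 - log K / N) + (log A - log B)/N, both `O(M³/N) = O(1/M)`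
    have key : (N)⁻¹ * (6 * N * (Real.log (Real.cosh β) - β) + Real.log (closedSum M t) -
        (-(4 * N) * Real.log 2 + Real.log (flatCount 4 M : ℝ) + Real.log (exactSum 4 M t))) -
        (3 * Real.log 2 + 6 * Real.log (Real.cosh β) - 6 * β) =
        (N)⁻¹ * ((N * Real.log 2 - Real.log (flatCount 4 M : ℝ)) +
          (Real.log (closedSum M t) - Real.log (exactSum 4 M t))) := by
      field_simp
      ring
    rw [key, abs_mul, abs_inv, abs_of_pos hNpos]
    rw [inv_mul_le_iff₀ hNpos]
    have hM3 : (1 : ℝ) ≤ (M : ℝ) ^ 3 := one_le_pow₀ hM1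
    have hlog2 : 0 < Real.log 2 := Real.log_pos one_lt_two
    have hlogt : 0 ≤ Real.log (2 / t) := Real.log_nonneg (by rw [le_div_iff₀ ht0]; linarith)
    calc |(N * Real.log 2 - Real.log (flatCount 4 M : ℝ)) +
          (Real.log (closedSum M t) - Real.log (exactSum 4 M t))|
        ≤ |N * Real.log 2 - Real.log (flatCount 4 M : ℝ)| +
          |Real.log (closedSum M t) - Real.log (exactSum 4 M t)| := abs_add_le _ _
      _ ≤ (1 + 4 * (M : ℝ) ^ 3) * Real.log 2 + 32 * (M : ℝ) ^ 3 * Real.log (2 / t) := by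
          refine add_le_add ?_ ?_
          · rw [abs_sub_comm, hNM]; exact hK
          · rw [abs_of_nonneg hAB0]; exact hAB1
      _ ≤ C * (M : ℝ) ^ 3 := by rw [hC]; nlinarith
      _ = N * (C / (M : ℝ)) := by
          rw [hNM]; field_simp
  -- conclude by squeezing
  rw [Metric.tendsto_atTop]
  intro ε hε
  have hCpos : 0 < C := by
    have hlog2 : 0 < Real.log 2 := Real.log_pos one_lt_two
    have hlogt : 0 ≤ Real.log (2 / t) := Real.log_nonneg (by rw [le_div_iff₀ ht0]; linarith)
    rw [hC]; positivity
  obtain ⟨L₀, hL₀⟩ := exists_nat_gt (C / ε)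
  refine ⟨max L₀ 1, fun L hL => ?_⟩
  have hL1 : 1 ≤ L := le_trans (le_max_right _ _) hL
  have hLL : (L₀ : ℝ) ≤ L := by exact_mod_cast le_trans (le_max_left _ _) hL
  rw [Real.dist_eq]
  refine lt_of_le_of_lt (hmain L hL1) ?_
  rw [div_lt_iff₀ (by positivity)]
  push_cast
  have : C < ε * (L₀ : ℝ) := by rwa [div_lt_iff₀ hε, mul_comm] at hL₀
  nlinarith

end Summit.QuantumFields.YangMills.Theorems.Z2SelfDuality
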